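import Summits.CriticalPhenomena.PercolationContinuityZ3.Theorems.Transplant.OrthantUniquenessStations
import Summits.CriticalPhenomena.PercolationContinuityZ3.Theorems.Transplant.OrthantUniquenessLinkMove
import HarnessLib

/-!
# The all-arms chain of an inner-boundary vertex, II: regions inside the orthant, the chain event, the move to the terminal

builds on p205010 (kernel theorem, internal audit signed; external expert review pending) — nothing in this file uses p205010.
Lane `prim-bschramm`, seat `prim-bschramm-p2` gen 17 (class C1b); helper file (`--supports stmt-CriticalPhenomena-4575 --as helper`)
for the ORTHANT uniqueness programme (Barsky–Grimmett–Newman 1991, Cor. to Thm 1.1 (iii)/(iv) for `ℤ^{d-ℓ} × ℤ₊^ℓ`, all `ℓ ≥ 1`,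
all `d ≥ 2`).  Continues `OrthantUniquenessStations` (stations, constants, link inequalities) and `OrthantUniquenessLinkMove`.

* §1 `link0_good`, `linkS_good`: every point of every arm region lies in `𝕆_I` (constrained coordinates stay `≥ 0`: apex lifted to
  `≥ k`, canonical targets `0`, outward signs on constrained planes) and off the box (link 0: the face coordinate, or the height when
  the face is the top face `{x_0 = N}`; later links: height `≥ H₀ - k > N`); `link0_window`, `linkS_window`: inside `[-M, M]^d`;
* §2 `chainEvent` = link 0 ∩ links `1, …, d-1`; increasing, measurable, determined by the edges in `[-M, M]^d`,
  **`P_{p'}(chainEvent) ≥ α² (α²)^{d-1}`** (Harris);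
* §3 **`chain_move`**: on the chain event, `≤ (k+1) + dk + d·2dk` extra open edges inside `[-M, M]^d` (escape segment, lift, one junction
  per link) join `u` to the common terminal `Ω` through open EXTERIOR steps of the box in the orthant.
[cite: BarskyGrimmettNewman1991, Comment 6 p. 116, Cor. (iii)] [cite: AizenmanChayesChayesFrohlichRusso1983, §4 Lemma 4.3, Cor., Lemma 4.2 (a)] -/

noncomputable section

namespace Summit.CriticalPhenomena.PercolationContinuityZ3.Theorems.Transplant

namespace OrthantUniq

open MeasureTheory Literature.Probability.Percolation Literature.Probability.LatticeModels SimpleGraph PlanarCone HSU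
open scoped Classical

variable {d : ℕ} [NeZero d] {p' : unitInterval} (A : ArmKit d p') (hd : 2 ≤ d) {I : Finset (Fin d)} {N : ℕ} {F : Face d}

/-! ## §1 The arm regions lie in the orthant, off the box, inside the window -/

/-- **Link 0's regions are in `𝕆_I` off the box.** [folklore] -/
theorem link0_good (hF : FaceOK I N F) (hI0 : (0 : Fin d) ∈ I) {x : Site d}
    (hx : x ∈ steepReg A (apex I N A.k F) (plane0 hd F.c) (sign0 F) (T0 N A.k) ∪
      shallowReg A (apex I N A.k F) (plane0 hd F.c) (sign0 F) (H0 N A.k) (c0 hd I N A.k F) (t0 hd I N A.k F)) :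
    x ∈ orth I ∧ x ∉ boxSet d N := by
  have hL := linkOK_zero hd A.k hF hI0
  obtain ⟨hc, -, -, hge, h0k, -, -⟩ := apex_facts A.k hF hI0
  have hp0 := plane0_ne_zero hd F
  have hsI : plane0 hd F.c ∈ I → sign0 F = 1 := sign0_eq_one_of_mem hd hF
  have hH0 : (H0 N A.k : ℤ) = N + 2 * A.k + 2 := by simp [H0]
  rcases hx with hx | hx
  · obtain ⟨s1, -, s3, -, s5⟩ := steepReg_props A hL hx
    refine ⟨fun j hj => ?_, ?_⟩
    · by_cases hj0 : j = 0
      · subst hj0; omega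
      · by_cases hjp : j = plane0 hd F.c
        · subst hjp; rw [hsI hj, one_mul] at s1; have := hge _ hj; omega
        · have h1 := s5 j hj0 hjp; have h2 := hge j hj; rw [abs_le] at h1; omega
    · by_cases hc0 : F.c = 0
      · -- top face: the apex sits at height `N + k + 1`
        have hσ1 : F.σ = 1 := hF.2.2.2.2 (hc0 ▸ hI0)
        rw [hc0, hσ1, one_mul] at hc
        exact not_mem_boxSet_of_lt (j := 0) (by rw [abs_of_nonneg (by omega)]; omega)
      · -- side face `c ≠ 0`: the plane is `(x_0, x_c)`, the steep cone opens outwards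
        have hpc : plane0 hd F.c = F.c := by simp [plane0, hc0]
        have hsc : sign0 F = F.σ := by simp [sign0, hc0]
        rw [hpc, hsc, hc] at s1
        refine not_mem_boxSet_of_lt (j := F.c) ?_
        rcases hF.1 with h | h <;> rw [h] at s1
        · have := le_abs_self (x F.c); nlinarith
        · have := neg_abs_le (x F.c); nlinarith
  · obtain ⟨h1, -, -, h4, -, h6⟩ := shallowReg_props A hL hx
    refine ⟨fun j hj => ?_, not_mem_boxSet_of_lt (j := 0) (by rw [abs_of_nonneg (by omega)]; omega)⟩
    by_cases hj0 : j = 0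
    · subst hj0; omega
    · by_cases hjp : j = plane0 hd F.c
      · subst hjp; rw [hsI hj, one_mul, one_mul, t0, hsI hj, one_mul] at h4; have := hge _ hj; omega
      · have h1 := h6 j hj0 hjp; have h2 := hge j hj; rw [abs_le] at h1; omega

/-- **Link `n+1`'s regions are in `𝕆_I` off the box** (everything at heights `> N`). [folklore] -/
theorem linkS_good (hF : FaceOK I N F) (hI0 : (0 : Fin d) ∈ I) {n : ℕ} (h : n + 1 < d) {x : Site d}
    (hx : x ∈ steepReg A (station hd I N A.k F n) ⟨n + 1, h⟩ 1 (Tn N A.k (n + 1)) ∪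
      shallowReg A (station hd I N A.k F n) ⟨n + 1, h⟩ 1 (Hn N A.k (n + 1)) (Cn N A.k (n + 1)) (tco I N A.k ⟨n + 1, h⟩)) :
    x ∈ orth I ∧ x ∉ boxSet d N := by
  have hL := linkOK_succ hd A.k hF hI0 h
  obtain ⟨h0, -, -, hge, -⟩ := station_facts hd A.k hF hI0 (show n < d by omega)
  have hj0 : (⟨n + 1, h⟩ : Fin d) ≠ 0 := by simp [Fin.ext_iff]
  have hH0 : (H0 N A.k : ℤ) = N + 2 * A.k + 2 := by simp [H0]
  have hHn0 : (H0 N A.k : ℤ) ≤ Hn N A.k n := by exact_mod_cast (constants_mono N A.k (Nat.zero_le n)).2.2.2.2.2.2.2.2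
  have hHn1 : (H0 N A.k : ℤ) ≤ Hn N A.k (n + 1) := by exact_mod_cast (constants_mono N A.k (Nat.zero_le (n + 1))).2.2.2.2.2.2.2.2
  rcases hx with hx | hx
  · obtain ⟨s1, -, s3, -, s5⟩ := steepReg_props A hL hx
    rw [h0] at s3
    refine ⟨fun j hj => ?_, not_mem_boxSet_of_lt (j := 0) (by rw [abs_of_nonneg (by omega)]; omega)⟩
    by_cases hj0' : j = 0
    · subst hj0'; omega
    · by_cases hjp : j = ⟨n + 1, h⟩
      · subst hjp; rw [one_mul] at s1; have := hge _ hj hj0; omega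
      · have h1 := s5 j hj0' hjp; have h2 := hge j hj hj0'; rw [abs_le] at h1; omega
  · obtain ⟨h1, -, -, h4, -, h6⟩ := shallowReg_props A hL hx
    refine ⟨fun j hj => ?_, not_mem_boxSet_of_lt (j := 0) (by rw [abs_of_nonneg (by omega)]; omega)⟩
    by_cases hj0' : j = 0
    · subst hj0'; omega
    · by_cases hjp : j = ⟨n + 1, h⟩
      · subst hjp; rw [one_mul, one_mul, tco, if_pos hj] at h4; omega
      · have h1 := h6 j hj0' hjp; have h2 := hge j hj hj0'; rw [abs_le] at h1; omega

/-- **Link 0's regions lie in the window `[-M, M]^d`.** [folklore] -/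
theorem link0_window (hF : FaceOK I N F) (hI0 : (0 : Fin d) ∈ I) {x : Site d}
    (hx : x ∈ steepReg A (apex I N A.k F) (plane0 hd F.c) (sign0 F) (T0 N A.k) ∪
      shallowReg A (apex I N A.k F) (plane0 hd F.c) (sign0 F) (H0 N A.k) (c0 hd I N A.k F) (t0 hd I N A.k F)) :
    ∀ j, |x j| ≤ (Mbig (d := d) N A.k : ℕ) := by
  have hL := linkOK_zero hd A.k hF hI0
  obtain ⟨-, -, -, -, -, -, habs, -⟩ := apex_facts A.k hF hI0
  obtain ⟨-, hpp, -, -, hB⟩ := station_zero_facts hd A.k hF hI0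
  obtain ⟨m1, m2, m3, m4, m5, m6, m7, m8, m9⟩ := constants_mono N A.k (Nat.zero_le (d - 1))
  have hc0 : |c0 hd I N A.k F| ≤ Cn N A.k (d - 1) := by
    rw [← hpp]; exact (hB _ (plane0_ne_zero hd F)).trans (by exact_mod_cast m6)
  have ht0 : |t0 hd I N A.k F| ≤ Cn N A.k (d - 1) := by
    have h1 := habs (plane0 hd F.c); rw [abs_le] at h1
    have hBc' : N + A.k + 1 + A.k ≤ Cn N A.k (d - 1) := by unfold Cn Bc D0 H0 Tn; omega
    have hBc : (N : ℤ) + A.k + 1 + A.k ≤ (Cn N A.k (d - 1) : ℕ) := by exact_mod_cast hBc'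
    rw [t0, abs_le]
    rcases sign0_cases F hF.1 with h | h <;> rw [h] <;> constructor <;> omega
  refine regions_window A hL (Mb := Cn N A.k (d - 1)) (Mp := Cn N A.k (d - 1)) (fun j => (habs j).trans (by exact_mod_cast m8.trans m6))
    (by rw [Nat.abs_cast]; exact_mod_cast m9.trans (m4.trans m5)) hc0 (by rw [Nat.abs_cast]; exact_mod_cast m7) ht0 hx

/-- **Link `n+1`'s regions lie in the window `[-M, M]^d`.** [folklore] -/
theorem linkS_window (hF : FaceOK I N F) (hI0 : (0 : Fin d) ∈ I) {n : ℕ} (h : n + 1 < d) {x : Site d}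
    (hx : x ∈ steepReg A (station hd I N A.k F n) ⟨n + 1, h⟩ 1 (Tn N A.k (n + 1)) ∪
      shallowReg A (station hd I N A.k F n) ⟨n + 1, h⟩ 1 (Hn N A.k (n + 1)) (Cn N A.k (n + 1)) (tco I N A.k ⟨n + 1, h⟩)) :
    ∀ j, |x j| ≤ (Mbig (d := d) N A.k : ℕ) := by
  have hL := linkOK_succ hd A.k hF hI0 h
  obtain ⟨-, -, -, -, habs⟩ := station_facts hd A.k hF hI0 (show n < d by omega)
  obtain ⟨m1, m2, m3, m4, m5, m6, m7, m8, m9⟩ := constants_mono N A.k (show n + 1 ≤ d - 1 by omega)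
  have ht : |tco I N A.k ⟨n + 1, h⟩| ≤ Cn N A.k (d - 1) := by
    have hBc' : Bc N A.k + A.k ≤ Cn N A.k (d - 1) := by unfold Cn Tn; omega
    have hBc : (Bc N A.k : ℤ) + A.k ≤ (Cn N A.k (d - 1) : ℕ) := by exact_mod_cast hBc'
    rw [tco, abs_le]; split_ifs <;> constructor <;> omega
  exact regions_window A hL (Mb := Cn N A.k (d - 1)) (Mp := Cn N A.k (d - 1)) habs
    (by rw [Nat.abs_cast]; exact_mod_cast m1.trans (m4.trans m5)) (by rw [Nat.abs_cast]; exact_mod_cast m3)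
    (by rw [Nat.abs_cast]; exact_mod_cast m2.trans m5) ht hx

/-! ## §2 The chain event -/

/-- The event of link `n+1` (the sure event beyond the last link). [folklore] -/
def linkEv (A : ArmKit d p') (hd : 2 ≤ d) (I : Finset (Fin d)) (N : ℕ) (F : Face d) (n : ℕ) : Set (BondConfig (Site d)) :=
  if h : n + 1 < d then linkEvent A (station hd I N A.k F n) ⟨n + 1, h⟩ 1 (Hn N A.k (n + 1)) (Cn N A.k (n + 1)) (Tn N A.k (n + 1))
    (tco I N A.k ⟨n + 1, h⟩) else Set.univ

/-- **The chain event** of a boundary vertex: link 0 and the links `1, …, d-1` all occur.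
[cite: AizenmanChayesChayesFrohlichRusso1983, §4 Cor. to Lemma 4.3] -/
def chainEvent (A : ArmKit d p') (hd : 2 ≤ d) (I : Finset (Fin d)) (N : ℕ) (F : Face d) : Set (BondConfig (Site d)) :=
  linkEvent A (apex I N A.k F) (plane0 hd F.c) (sign0 F) (H0 N A.k) (c0 hd I N A.k F) (T0 N A.k) (t0 hd I N A.k F) ∩
    ⋂ n ∈ Finset.range (d - 1), linkEv A hd I N F n

/-- The chain event is increasing. [folklore] -/
theorem chainEvent_upper : IsUpperSet (chainEvent A hd I N F) := by
  refine (linkEvent_upper A).inter (isUpperSet_biInter_finset _ _ fun n => ?_)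
  unfold linkEv; split_ifs
  · exact linkEvent_upper A
  · exact isUpperSet_univ

/-- The chain event is measurable. [folklore] -/
theorem chainEvent_measurable : MeasurableSet (chainEvent A hd I N F) := by
  refine (linkEvent_measurable A).inter (Finset.measurableSet_biInter _ fun n _ => ?_)
  unfold linkEv; split_ifs
  · exact linkEvent_measurable A
  · exact MeasurableSet.univ

/-- **Locality**: the chain event is determined by the lattice edges inside `[-M, M]^d`. [folklore] -/
theorem chainEvent_determinedBy (hF : FaceOK I N F) (hI0 : (0 : Fin d) ∈ I) :
    DeterminedBy (chainEvent A hd I N F) ↑(edgesIn (zdGraph d) (box d (Mbig (d := d) N A.k))) := by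
  refine (linkEvent_determinedBy A fun x hx => link0_window A hd hF hI0 hx).inter (determinedBy_biInter_finset _ _ fun n => ?_)
  unfold linkEv; split_ifs with h
  · exact linkEvent_determinedBy A fun x hx => linkS_window A hd hF hI0 h hx
  · exact determinedBy_univ _

/-- **`P_{p'}(chainEvent) ≥ α² (α²)^{d-1}`** (each link `≥ α²`, Harris). [cite: AizenmanChayesChayesFrohlichRusso1983, §4 Lemma 4.3 (FKG)] -/
theorem chainEvent_prob (hF : FaceOK I N F) (hI0 : (0 : Fin d) ∈ I) :
    A.α ^ 2 * (A.α ^ 2) ^ (d - 1) ≤ (bondPercolation (zdGraph d) p').real (chainEvent A hd I N F) := by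
  have hα1 : A.α ≤ 1 := (A.steep_arm ⟨1, hd⟩ (by simp [Fin.ext_iff]) 1 (Or.inl rfl) 0).trans measureReal_le_one
  have hα0 : 0 ≤ A.α ^ 2 := pow_nonneg A.α_pos.le 2
  have hlink : ∀ n, A.α ^ 2 ≤ (bondPercolation (zdGraph d) p').real (linkEv A hd I N F n) := by
    intro n; unfold linkEv; split_ifs with h
    · exact link_prob A (linkOK_succ hd A.k hF hI0 h)
    · rw [probReal_univ]; exact pow_le_one₀ A.α_pos.le hα1
  have hup : ∀ n, IsUpperSet (linkEv A hd I N F n) := fun n => by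
    unfold linkEv; split_ifs
    · exact linkEvent_upper A
    · exact isUpperSet_univ
  have hmeas : ∀ n, MeasurableSet (linkEv A hd I N F n) := fun n => by
    unfold linkEv; split_ifs
    · exact linkEvent_measurable A
    · exact MeasurableSet.univ
  have hprod : (A.α ^ 2) ^ (d - 1) ≤ (bondPercolation (zdGraph d) p').real (⋂ n ∈ Finset.range (d - 1), linkEv A hd I N F n) := by
    refine le_trans ?_ (harris_finset_prod (zdGraph d) p' (Finset.range (d - 1)) _ hup hmeas)
    calc (A.α ^ 2) ^ (d - 1) = ∏ _n ∈ Finset.range (d - 1), A.α ^ 2 := by rw [Finset.prod_const, Finset.card_range]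
      _ ≤ _ := Finset.prod_le_prod (fun _ _ => hα0) fun n _ => hlink n
  exact harris2_of_le p' (linkEvent_upper A) (isUpperSet_biInter_finset _ _ hup) (linkEvent_measurable A)
    (Finset.measurableSet_biInter _ fun n _ => hmeas n) hα0 (link_prob A (linkOK_zero hd A.k hF hI0)) hprod

/-! ## §3 The move: from the boundary vertex to the terminal -/

/-- **The move on the chain event.** On `chainEvent`, some `≤ (k+1) + dk + d·(2dk)` lattice edges inside `[-M, M]^d`, declared open,
join `u` to the common terminal `Ω` through open EXTERIOR steps of the box in the orthant: the escape segment `u → corner`, the lift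
`corner → apex`, and one junction per link (`link_move`), the links chaining `apex → station 0 → ⋯ → station (d-1) = Ω`.
[cite: AizenmanChayesChayesFrohlichRusso1983, §4 Cor. to Lemma 4.3 and Lemma 4.2 (a)] -/
theorem chain_move (hF : FaceOK I N F) (hI0 : (0 : Fin d) ∈ I) {ω : BondConfig (Site d)} (hω : ω ∈ chainEvent A hd I N F) :
    ∃ Fs : Finset (Sym2 (Site d)), Fs ⊆ edgesIn (zdGraph d) (box d (Mbig (d := d) N A.k)) ∧
      Fs.card ≤ (A.k + 1) + d * A.k + d * (d * (2 * A.k)) ∧ ω ∪ ↑Fs ∈ openConnVia (oextGraph I N) F.u (omega N A.k) := by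
  obtain ⟨hσ, huO, hubox, huc, hcI⟩ := hF
  have hF' : FaceOK I N F := ⟨hσ, huO, hubox, huc, hcI⟩
  obtain ⟨hc, -, -, -, -, -, habs, haO, hcO, hdiff, hcr, hcc⟩ := apex_facts A.k hF' hI0
  obtain ⟨m1, m2, m3, m4, m5, m6, m7, m8, m9⟩ := constants_mono N A.k (Nat.zero_le (d - 1))
  have hMbig : (Cn N A.k (d - 1) : ℤ) ≤ (Mbig (d := d) N A.k : ℕ) := by unfold Mbig; push_cast; omega
  have hub : ∀ j, |F.u j| ≤ (Mbig (d := d) N A.k : ℕ) := fun j => by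
    have := (mem_boxSet_iff.1 hubox) j; rw [abs_le]; constructor <;> omega
  have hcb : ∀ j, |corner N A.k F j| ≤ (Mbig (d := d) N A.k : ℕ) := fun j => by
    by_cases hj : j = F.c
    · rw [hj, hcc]; rcases hσ with h | h <;> rw [h, abs_le] <;> constructor <;> omega
    · rw [hcr j hj]; exact hub j
  have hab : ∀ j, |apex I N A.k F j| ≤ (Mbig (d := d) N A.k : ℕ) := fun j => (habs j).trans (by omega)
  set K := oextGraph I N with hK
  -- escape segment and lift
  obtain ⟨J₁, hJ₁c, hJ₁s, hJ₁r⟩ := exists_junction F.u (corner N A.k F)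
  obtain ⟨J₂, hJ₂c, hJ₂s, hJ₂r⟩ := exists_junction (corner N A.k F) (apex I N A.k F)
  have hσabs : F.σ.natAbs = 1 := by rcases hσ with h | h <;> rw [h] <;> rfl
  have hd1 : l1dist F.u (corner N A.k F) ≤ A.k + 1 := by
    rw [l1dist_of_eq_off F.c fun j hj => (hcr j hj).symm, huc, hcc]
    have : F.σ * (N : ℤ) - F.σ * (N + A.k + 1) = -(F.σ * (A.k + 1)) := by ring
    rw [this, Int.natAbs_neg, Int.natAbs_mul, hσabs, one_mul]; omega
  have hd2 : l1dist (corner N A.k F) (apex I N A.k F) ≤ d * A.k :=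
    l1dist_le_of_forall_le fun j => by rw [abs_sub_comm]; exact hdiff j
  have hJ₁K : withinGraph (zdGraph d) {z | ∀ j, min (F.u j) (corner N A.k F j) ≤ z j ∧ z j ≤ max (F.u j) (corner N A.k F j)} ≤ K :=
    bbox_segment_le_oextGraph hσ huO huc hcI (by rw [hcc]; rcases hσ with h | h <;> rw [h] <;> omega) hcr
  have hJ₂K : withinGraph (zdGraph d) {z | ∀ j, min (corner N A.k F j) (apex I N A.k F j) ≤ z j ∧
      z j ≤ max (corner N A.k F j) (apex I N A.k F j)} ≤ K :=
    bbox_le_oextGraph_of_coord hcO haO F.c (by rw [hcc, hc]) (by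
      rw [hcc]; rcases hσ with h | h <;> rw [h]
      · rw [one_mul, abs_of_nonneg (by positivity)]; omega
      · rw [neg_one_mul, abs_neg, abs_of_nonneg (by positivity)]; omega)
  -- link 0
  have hL0 := linkOK_zero hd A.k hF' hI0
  obtain ⟨G₀, hG₀s, hG₀c, hG₀r⟩ := link_move A hL0 (K := K)
    (withinGraph_le_oextGraph_of_forall_not_mem fun x hx => link0_good A hd hF' hI0 (Or.inl hx))
    (withinGraph_le_oextGraph_of_forall_not_mem fun x hx => link0_good A hd hF' hI0 (Or.inr hx))
    (fun x hx y hy hi h0 => bbox_le_oextGraph_of_height (link0_good A hd hF' hI0 (Or.inl hx)).1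
      (link0_good A hd hF' hI0 (Or.inr hy)).1 h0 (by
        rw [h0]; have := (shallowReg_props A hL0 hy).1; have : (H0 N A.k : ℤ) = N + 2 * A.k + 2 := by simp [H0]
        omega))
    (fun x hx => link0_window A hd hF' hI0 hx) hω.1
  have hst0 : linkPort (apex I N A.k F) (plane0 hd F.c) (H0 N A.k) (c0 hd I N A.k F) = station hd I N A.k F 0 := by
    rw [station, c0]
  rw [hst0] at hG₀r
  -- links `n + 1`
  have hlink : ∀ n : ℕ, ∃ G : Finset (Sym2 (Site d)), G ⊆ edgesIn (zdGraph d) (box d (Mbig (d := d) N A.k)) ∧ G.card ≤ d * (2 * A.k) ∧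
      ∀ h : n + 1 < d, ω ∪ ↑G ∈ openConnVia K (station hd I N A.k F n) (station hd I N A.k F (n + 1)) := by
    intro n
    by_cases h : n + 1 < d
    · have hLn := linkOK_succ hd A.k hF' hI0 h
      have hωn : ω ∈ linkEv A hd I N F n := Set.mem_iInter₂.1 hω.2 n (Finset.mem_range.2 (by omega))
      rw [linkEv, dif_pos h] at hωn
      obtain ⟨G, hGs, hGc, hGr⟩ := link_move A hLn (K := K)
        (withinGraph_le_oextGraph_of_forall_not_mem fun x hx => linkS_good A hd hF' hI0 h (Or.inl hx))
        (withinGraph_le_oextGraph_of_forall_not_mem fun x hx => linkS_good A hd hF' hI0 h (Or.inr hx))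
        (fun x hx y hy hi h0 => bbox_le_oextGraph_of_height (linkS_good A hd hF' hI0 h (Or.inl hx)).1
          (linkS_good A hd hF' hI0 h (Or.inr hy)).1 h0 (by
            rw [h0]; have := (shallowReg_props A hLn hy).1
            have : (H0 N A.k : ℤ) ≤ Hn N A.k (n + 1) := by exact_mod_cast (constants_mono N A.k (Nat.zero_le (n + 1))).2.2.2.2.2.2.2.2
            have : (H0 N A.k : ℤ) = N + 2 * A.k + 2 := by simp [H0]
            omega))
        (fun x hx => linkS_window A hd hF' hI0 h hx) hωn
      refine ⟨G, hGs, hGc, fun _ => ?_⟩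
      rwa [station_succ hd I N A.k F h]
    · exact ⟨∅, by simp, by simp, fun h' => (h h').elim⟩
  choose G hGs hGc hGr using hlink
  -- the edge set
  set Fs := J₁ ∪ J₂ ∪ G₀ ∪ (Finset.range (d - 1)).biUnion G with hFs
  have hωF : ∀ G' : Finset (Sym2 (Site d)), G' ⊆ Fs → ω ∪ ↑G' ⊆ ω ∪ ↑Fs := fun G' hG' =>
    Set.union_subset_union_right _ (Finset.coe_subset.2 hG')
  have hGsub : ∀ n, n < d - 1 → G n ⊆ Fs := fun n hn =>
    (Finset.subset_biUnion_of_mem G (Finset.mem_range.2 hn)).trans Finset.subset_union_right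
  refine ⟨Fs, ?_, ?_, ?_⟩
  · intro e he
    rcases Finset.mem_union.1 he with he | he
    · rcases Finset.mem_union.1 he with he | he
      · rcases Finset.mem_union.1 he with he | he
        · exact edgeSet_withinGraph_subset_edgesIn (bbox_subset_boxSet hub hcb) (hJ₁s (Finset.mem_coe.2 he))
        · exact edgeSet_withinGraph_subset_edgesIn (bbox_subset_boxSet hcb hab) (hJ₂s (Finset.mem_coe.2 he))
      · exact hG₀s he
    · obtain ⟨n, -, hn⟩ := Finset.mem_biUnion.1 he
      exact hGs n hn
  · have hbU : ((Finset.range (d - 1)).biUnion G).card ≤ (d - 1) * (d * (2 * A.k)) := by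
      calc ((Finset.range (d - 1)).biUnion G).card ≤ ∑ n ∈ Finset.range (d - 1), (G n).card := Finset.card_biUnion_le
        _ ≤ ∑ _n ∈ Finset.range (d - 1), d * (2 * A.k) := Finset.sum_le_sum fun n _ => hGc n
        _ = (d - 1) * (d * (2 * A.k)) := by rw [Finset.sum_const, Finset.card_range, smul_eq_mul]
    have hd1 : d - 1 + 1 = d := by omega
    calc Fs.card ≤ (J₁ ∪ J₂ ∪ G₀).card + ((Finset.range (d - 1)).biUnion G).card := Finset.card_union_le _ _
      _ ≤ ((J₁.card + J₂.card) + G₀.card) + ((Finset.range (d - 1)).biUnion G).card := by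
          gcongr; exact (Finset.card_union_le _ _).trans (by gcongr; exact Finset.card_union_le _ _)
      _ ≤ ((A.k + 1 + d * A.k) + d * (2 * A.k)) + (d - 1) * (d * (2 * A.k)) := by gcongr <;> omega
      _ = (A.k + 1) + d * A.k + (d - 1 + 1) * (d * (2 * A.k)) := by ring
      _ = (A.k + 1) + d * A.k + d * (d * (2 * A.k)) := by rw [hd1]
  · -- the chain of connections
    have r1 : (openGraph (ω ∪ ↑Fs) ⊓ K).Reachable F.u (corner N A.k F) :=
      reachable_of_junction hJ₁r (Finset.subset_union_left.trans (Finset.subset_union_left.trans Finset.subset_union_left)) hJ₁K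
    have r2 : (openGraph (ω ∪ ↑Fs) ⊓ K).Reachable (corner N A.k F) (apex I N A.k F) :=
      reachable_of_junction hJ₂r (Finset.subset_union_right.trans (Finset.subset_union_left.trans Finset.subset_union_left)) hJ₂K
    have r3 : (openGraph (ω ∪ ↑Fs) ⊓ K).Reachable (apex I N A.k F) (station hd I N A.k F 0) :=
      mem_openConnVia_iff.1 (isUpperSet_openConnVia _ _ _ (hωF G₀ (Finset.subset_union_right.trans Finset.subset_union_left)) hG₀r)
    have key : ∀ n, n < d → (openGraph (ω ∪ ↑Fs) ⊓ K).Reachable F.u (station hd I N A.k F n) := by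
      intro n hn
      induction n with
      | zero => exact r1.trans (r2.trans r3)
      | succ n ih =>
        refine (ih (by omega)).trans ?_
        exact mem_openConnVia_iff.1 (isUpperSet_openConnVia _ _ _ (hωF (G n) (hGsub n (by omega))) (hGr n hn))
    have := key (d - 1) (by omega)
    rw [station_last hd I N A.k F] at this
    exact mem_openConnVia_iff.2 this

end OrthantUniq

end Summit.CriticalPhenomena.PercolationContinuityZ3.Theorems.Transplant

end
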